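import Mathlib.NumberTheory.SiegelsLemma
import Mathlib.Combinatorics.Pigeonhole
import Mathlib.Analysis.SpecialFunctions.Pow.Real
import HarnessLib

/-!
# Cell abc-stewartyu, WP-Y (route M2 `PadicPrimesYuNinety`, infrastructure I3): Siegel's lemma for
# unknowns indexed by an ARBITRARY finite set (a class-restricted box), and the pigeonhole choice of
# the class

`Summits/ABC/StewartYu/SiegelOnFinset.lean` — cell `abc-stewartyu` (HOME
`run/shared/lean/pub/abc-stewartyu/`, seat p3; theorems only, no definition, no named fact).

The landed level-`0` step `PadicCW77.Setup.siegel_step` (`PadicCW77Siegel.lean`, Cijsouw–Waldschmidt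
1977 §4 Step 1) applies Mathlib's Siegel lemma (`Int.Matrix.exists_ne_zero_int_vec_norm_le`, exponent
`1` when `#unknowns ≥ 2·#equations`) to the unknowns indexed by the FULL box `S.frame.box L L_θ 0` of
that particular set-up. Yu's twist engines (Yu 1990 §2, Lemma 2.1 pp. 40–43: the Siegel step with
CONGRUENCE CLASSES, unknowns `λ` in the box with `r·λ ≡ r^{(0)} (mod G₁)`; the cell's designs
HOME/p3/memo-03-odd-twist-engine.md §2 (V) and p2-g2 STATUS 2026-08-26T04:44Z (a): classes modulo
`(p−1)/2`) need the same step for the unknowns indexed by `box ∩ class`, for set-ups that are not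
`PadicCW77.Setup`. This file isolates the SET-UP-FREE core once, for all three engines (Y3/Y1/Y2):

* `exists_int_vec_of_finset` — unknowns indexed by any `U : Finset ι`, equations by any
  `E : Finset κ`, rational coefficients `coeff e u` with clearing denominators `D e > 0`
  (`D e · coeff e u ∈ ℤ`) and a bound `|D e · coeff e u| ≤ Amax` (`Amax ≥ 1`); if `2·#E ≤ #U` and
  `E` is non-empty then there is `p : ι → ℤ` supported in `U`, not identically zero, with
  `|p u| ≤ ⌈#U · Amax⌉` and `∑_{u ∈ U} p u · coeff e u = 0` for every `e ∈ E`
  (verbatim the argument of `PadicCW77.Setup.siegel_step`, abstracted from `Idx`, `Dclear`, `qTerm`);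
* `exists_class_card_ge` — the pigeonhole choice of the class: for a map `cls : ι → γ` into a
  non-empty finite type with at most `N` elements, some fibre `U = B.filter (cls · = c)` has
  `#B ≤ N · #U` (Mathlib `Finset.exists_lt_card_fiber_of_mul_lt_card_of_maps_to`), so that the count
  `2·N·#E ≤ #B` for the full box gives `2·#E ≤ #U` for the class (`two_mul_card_le_of_class`).

Everything is [folklore]; nothing here is claimed to be in print. WHAT THIS IS NOT: not the Siegel
step of any particular engine (the clearing denominators, the coefficient bound `Amax` and the count
are the engine's — WP-A4-type numerics).
-/

noncomputable section

open Finset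

namespace Summit.ABC.StewartYu

namespace SiegelFinset

/-! ### Siegel's lemma on a finite set of unknowns -/

/-- **Siegel's lemma for unknowns indexed by an arbitrary finite set.** Unknowns `u ∈ U`, equations
`e ∈ E` (non-empty), rational coefficients with clearing denominators `D e > 0`, `D e · coeff e u ∈ ℤ`,
`|D e · coeff e u| ≤ Amax` (`Amax ≥ 1`), and the count `2·#E ≤ #U`: there is an integer vector
`p` supported in `U`, not all zero, with `|p u| ≤ ⌈#U · Amax⌉` and `∑_{u∈U} p u · coeff e u = 0` for
all `e ∈ E` (Mathlib's Siegel lemma with exponent `#E/(#U − #E) ≤ 1`). [folklore] -/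
theorem exists_int_vec_of_finset {ι κ : Type*} [DecidableEq ι] (U : Finset ι) (E : Finset κ)
    (hE : E.Nonempty) (hcard : 2 * E.card ≤ U.card) (coeff : κ → ι → ℚ) (D : κ → ℕ)
    (hD : ∀ e ∈ E, 0 < D e) (hint : ∀ e ∈ E, ∀ u ∈ U, ∃ z : ℤ, (D e : ℚ) * coeff e u = z)
    {Amax : ℝ} (hAmax : 1 ≤ Amax)
    (hA : ∀ e ∈ E, ∀ u ∈ U, |((D e : ℚ) * coeff e u : ℚ)| ≤ (Amax : ℝ)) :
    ∃ p : ι → ℤ, (∀ u, p u ≠ 0 → u ∈ U) ∧ (∃ u, p u ≠ 0) ∧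
      (∀ u, |p u| ≤ ⌈(U.card : ℝ) * Amax⌉) ∧
      ∀ e ∈ E, ∑ u ∈ U, (p u : ℚ) * coeff e u = 0 := by
  classical
  letI : SeminormedAddCommGroup (Matrix E U ℤ) := Matrix.seminormedAddCommGroup
  -- the integer matrix
  have hint' : ∀ (e : E) (u : U), ∃ z : ℤ, (D e.1 : ℚ) * coeff e.1 u.1 = z :=
    fun e u => hint e.1 e.2 u.1 u.2
  choose Az hAz using hint'
  set A : Matrix E U ℤ := Matrix.of fun e u => Az e u with hAdef
  -- cardinalities
  have hm : 0 < Fintype.card E := by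
    rw [Fintype.card_coe]; exact Finset.card_pos.mpr hE
  have hn : Fintype.card E < Fintype.card U := by
    rw [Fintype.card_coe, Fintype.card_coe]
    have : 0 < E.card := Finset.card_pos.mpr hE
    omega
  obtain ⟨t, ht0, hAt, htnorm⟩ := Int.Matrix.exists_ne_zero_int_vec_norm_le A hn hm
  -- entries of `A` are bounded by `Amax`, hence `‖t‖ ≤ #U · Amax`
  have hAnorm : ‖A‖ ≤ Amax := by
    rw [Matrix.norm_le_iff (by linarith)]
    intro e u
    have h1 := hAz e u
    have h2 := hA e.1 e.2 u.1 u.2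
    have hcast : (((D e.1 : ℚ) * coeff e.1 u.1 : ℚ) : ℝ) = ((Az e u : ℤ) : ℝ) := by
      rw [h1]; push_cast; rfl
    rw [hAdef, Matrix.of_apply, Int.norm_eq_abs]
    have h2' : |(((D e.1 : ℚ) * coeff e.1 u.1 : ℚ) : ℝ)| ≤ Amax := by
      rw [← Rat.cast_abs]; exact_mod_cast h2
    rwa [hcast] at h2'
  have htle : ∀ u : U, |(t u : ℝ)| ≤ (U.card : ℝ) * Amax := by
    intro u
    have h1 : ‖t u‖ ≤ ‖t‖ := norm_le_pi_norm t u
    rw [Int.norm_eq_abs] at h1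
    refine h1.trans (htnorm.trans ?_)
    have hbase : (1 : ℝ) ≤ (Fintype.card U : ℝ) * max 1 ‖A‖ := by
      have : (1 : ℝ) ≤ Fintype.card U := by exact_mod_cast (show 1 ≤ Fintype.card U by omega)
      nlinarith [le_max_left (1 : ℝ) ‖A‖]
    have hexp : (Fintype.card E : ℝ) / (Fintype.card U - Fintype.card E) ≤ 1 := by
      rw [div_le_one (by rw [sub_pos]; exact_mod_cast hn)]
      have : 2 * (Fintype.card E : ℝ) ≤ Fintype.card U := by
        rw [Fintype.card_coe, Fintype.card_coe]; exact_mod_cast hcard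
      linarith
    calc ((Fintype.card U : ℝ) * max 1 ‖A‖) ^ ((Fintype.card E : ℝ) / (Fintype.card U - Fintype.card E))
        ≤ ((Fintype.card U : ℝ) * max 1 ‖A‖) ^ (1 : ℝ) :=
          Real.rpow_le_rpow_of_exponent_le hbase hexp
      _ = (Fintype.card U : ℝ) * max 1 ‖A‖ := Real.rpow_one _
      _ ≤ (U.card : ℝ) * Amax := by
          rw [Fintype.card_coe]
          exact mul_le_mul_of_nonneg_left (max_le hAmax hAnorm) (by positivity)
  -- the vector `p`
  set p : ι → ℤ := fun u => if hu : u ∈ U then t ⟨u, hu⟩ else 0 with hp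
  have hp_mem : ∀ u (hu : u ∈ U), p u = t ⟨u, hu⟩ := fun u hu => by simp only [hp, dif_pos hu]
  refine ⟨p, ?_, ?_, ?_, ?_⟩
  · -- support
    intro u hu
    by_contra hnot
    exact hu (by simp only [hp, dif_neg hnot])
  · -- not all zero
    obtain ⟨u, hu⟩ := Function.ne_iff.mp ht0
    refine ⟨u.1, ?_⟩
    rw [hp_mem u.1 u.2]; exact hu
  · -- bound
    intro u
    by_cases hu : u ∈ U
    · rw [hp_mem u hu]
      have h1 := htle ⟨u, hu⟩
      have h2 : ((t ⟨u, hu⟩ : ℤ) : ℝ) ≤ ⌈(U.card : ℝ) * Amax⌉ :=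
        (le_abs_self _).trans (h1.trans (Int.le_ceil _))
      have h3 : (-(t ⟨u, hu⟩ : ℤ) : ℝ) ≤ ⌈(U.card : ℝ) * Amax⌉ :=
        (neg_le_abs _).trans (h1.trans (Int.le_ceil _))
      rw [abs_le]
      constructor
      · have : -(⌈(U.card : ℝ) * Amax⌉ : ℤ) ≤ t ⟨u, hu⟩ := by
          exact_mod_cast (by linarith : (-(⌈(U.card : ℝ) * Amax⌉ : ℤ) : ℝ) ≤ t ⟨u, hu⟩)
        exact this
      · exact_mod_cast h2
    · simp only [hp, dif_neg hu, abs_zero]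
      exact Int.ceil_nonneg (by positivity)
  · -- relations
    intro e he
    have hrow := congrFun hAt ⟨e, he⟩
    simp only [Matrix.mulVec, dotProduct, Pi.zero_apply] at hrow
    have hDq : ((D e : ℕ) : ℚ) ≠ 0 := by exact_mod_cast (hD e he).ne'
    have hsum : ((D e : ℕ) : ℚ) * ∑ u ∈ U, (p u : ℚ) * coeff e u =
        ((∑ u : U, A ⟨e, he⟩ u * t u : ℤ) : ℚ) := by
      rw [mul_sum, ← Finset.sum_coe_sort U]
      push_cast
      refine sum_congr rfl fun u _ => ?_
      rw [hAdef, Matrix.of_apply, ← hAz ⟨e, he⟩ u, hp_mem u.1 u.2]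
      ring
    rw [hrow] at hsum
    simp only [Int.cast_zero, mul_eq_zero] at hsum
    exact hsum.resolve_left hDq

/-! ### The pigeonhole choice of the class -/

/-- **Some class is large.** For a finite set `B` and a class map `cls : ι → γ` into a non-empty
finite type with at most `N` elements, some fibre `U = B.filter (cls · = c)` satisfies `#B ≤ N · #U`
(pigeonhole). [folklore] -/
theorem exists_class_card_ge {ι γ : Type*} [DecidableEq γ] [Fintype γ] [Nonempty γ] (B : Finset ι)
    (cls : ι → γ) {N : ℕ} (hN : Fintype.card γ ≤ N) :
    ∃ c : γ, B.card ≤ N * (B.filter fun u => cls u = c).card := by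
  classical
  rcases Nat.eq_zero_or_pos B.card with h0 | hBpos
  · obtain ⟨c⟩ := (inferInstance : Nonempty γ)
    exact ⟨c, by rw [h0]; exact Nat.zero_le _⟩
  have hpos : 0 < Fintype.card γ := Fintype.card_pos
  set n : ℕ := (B.card - 1) / Fintype.card γ with hn
  obtain ⟨c, -, hc⟩ := Finset.exists_lt_card_fiber_of_mul_lt_card_of_maps_to
    (s := B) (t := (Finset.univ : Finset γ)) (f := cls) (n := n)
    (fun u _ => Finset.mem_univ _)
    (by
      rw [Finset.card_univ]
      have h1 : Fintype.card γ * n ≤ B.card - 1 := Nat.mul_div_le (B.card - 1) (Fintype.card γ)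
      omega)
  refine ⟨c, ?_⟩
  have h2 : B.card - 1 < Fintype.card γ * (n + 1) := Nat.lt_mul_div_succ (B.card - 1) hpos
  have h3 : B.card ≤ Fintype.card γ * (n + 1) := by omega
  calc B.card ≤ Fintype.card γ * (n + 1) := h3
    _ ≤ N * (n + 1) := Nat.mul_le_mul_right _ hN
    _ ≤ N * (B.filter fun u => cls u = c).card := Nat.mul_le_mul_left _ hc

/-- **The count for the class.** If the full box satisfies `2·N·#E ≤ #B` then the large class `U`
of `exists_class_card_ge` satisfies the hypothesis `2·#E ≤ #U` of `exists_int_vec_of_finset`.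
[folklore] -/
theorem two_mul_card_le_of_class {B U E N : ℕ} (hN : 0 < N) (hU : B ≤ N * U)
    (hcount : 2 * N * E ≤ B) : 2 * E ≤ U := by
  have h : N * (2 * E) ≤ N * U := by
    calc N * (2 * E) = 2 * N * E := by ring
      _ ≤ B := hcount
      _ ≤ N * U := hU
  exact Nat.le_of_mul_le_mul_left h hN

end SiegelFinset

end Summit.ABC.StewartYu

end
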